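import Summits.BirchSwinnertonDyer.BirchSwinnertonDyer.Theorems.UniversalToricDescentThinCombSizeRigidity
import Literature.NumberTheory.LocalFields.PadicTeichmullerLimit
import HarnessLib

/-!
# TAME RIGIDITY OF ♯♯-FRAMES: the Teichmüller part of the grading ratio is killed by the grid exponent — for the exponent `m > 0` of a grid
# supply (one `m` for ALL frames) every non-zero ♯♯-frame with constants `(C, X, Y)` has `(X·κ̂/Y)^m ∈ 1 + 𝔪_{ℂ₃}`
# (helper on the rational wall `RationalSplitIMCInclusionAtThree`, stmt-BirchSwinnertonDyer-24207, line `ratwall_thin_comb` v10;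
# cell `pub/bsd-wall`, LEAD `cruxlead-24207` g37; `--supports stmt-BirchSwinnertonDyer-24207`; nothing is closed; BSD is not proved)

WHY THIS FILE. `…ThinComb.SizeRigidity` proved that a non-zero ♯♯-frame has `‖λ₀‖ = 1`, `λ₀ = X·κ̂/Y`: the reflected frame `G = φ_{A_τ}L₂` and
`L₂` take values on the grid supply (`…ThinComb.GridSupply`) related by `G(P_{ij})·μ^{i+1} = μ^{j+1}·L₂(P_{ij})`, `μ = λ₀^m`, and a size
`‖μ‖ ≠ 1` would make one family of values decay geometrically along the accumulating fibres. The SAME accumulation argument, run once more with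
the tree's Teichmüller limit (Robert III.4.4, `Literature…LocalFields.PadicComplex.tendsto_pow_prime_pow_factorial_nhds`: for `‖μ‖ = 1`,
`μ^{p^{n!}} → ζ`, the unique root of unity of order prime to `p` with `μ ≡ ζ (mod 𝔪)`), kills the TAME part of `μ`: along `i + p^{n!}` the grid
points of a fibre tend to the `i`-th point (`u^{p^{n!}} → 1`), the values of `L₂` and `G` tend to their values there (continuity in the outer
variable, `…ThinComb.ValueLimits`), and `μ^{i + p^{n!} + 1} → μ^{i+1}·ζ`; comparing the limit relation `G(P_{ij})·μ^{i+1}·ζ = μ^{j+1}·L₂(P_{ij})`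
with the relation at `(i, j)` gives `(ζ − 1)·G(P_{ij}) = 0`. So EITHER `ζ = 1`, i.e. **`μ = λ₀^m` is a one-unit**, OR all grid values vanish and
`L₂ = 0`.

* §1 `tendsto_of_hasValueAt₂` (general `p`) — the values of an `R₀`-series along a convergent sequence of outer points in a closed disc
  `‖x‖ ≤ ‖ϖ‖ < 1` (inner value fixed) CONVERGE to the value at the limit point (companion of `ValueLimits.hasValueAt₂_of_tendsto`).
* §2 `forall_eq_zero_or_norm_sub_one_lt_one_of_grid` (general `p`, pure analysis) — two series with grid values related by
  `VG i j · μ^{i+1} = μ^{j+1} · VL i j`, `‖μ‖ = 1`: all `VL i j = 0`, or `‖μ − 1‖ < 1`.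
* §3 **`exists_forall_norm_pow_sub_one_lt_one_of_isToricTwoVarLFunctionUpTo₂`** (`p = 3`) — in a `𝔭`-adapted pair at the split `3` (as in
  SizeRigidity; Jacquet's cone fact BY NAME) there is ONE exponent `m > 0` (the grid supply's) such that EVERY non-zero ♯♯-frame, whatever its
  constants `(C, X, Y)` with `X, Y ≠ 0`, has `‖(X·κ̂·Y⁻¹)^m − 1‖ < 1`. With size rigidity: `λ₀ = ζ·ν`, `ζ^m = 1` (order prime to `3`), `ν` a
  one-unit. WHAT REMAINS between «a non-zero frame exists» and (N♭) (`λ₀⁻¹ = u ∈ ℤ₃ˣ`): the WILD part `ν ∈ u^{ℤ₃}`-type condition (multiplicative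
  rigidity of `3`-adic exponentials; not attempted) and the torsion index `m` itself (types of conductor-one characters through the pair).

HONEST SCOPE: statements about the interpolation predicate, conditional on `jacquet1972_functionalEquation_rankinSelbergHecke_cone`; nothing here is
evidence that a frame exists at an additive split `3`; BSD is proved for no curve; 24207 / 20395 / 20186 / 32493 OPEN.

References: [cite: Robert2000PadicAnalysis, Ch. III §4.4 Theorem (pp. 183–184)] [cite: HaoLoeffler2025, Thm. 3.5, remark (arXiv:2405.12611)]
[cite: Gouvea1993PadicNumbers, §5.6 Cor. 5.6.3–5.6.4] [cite: Jacquet1972, §19 Cor. 19.15] [cite: Hida1988AIF, §5 Lemma 5.2 (ii)]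
-/

set_option linter.dupNamespace false
set_option autoImplicit false

noncomputable section

open scoped Classical MatrixGroups
open Filter Topology

namespace Summit.BirchSwinnertonDyer.BirchSwinnertonDyer.Theorems.UniversalToricDescentThinComb.TameRigidity

open NumberField IsDedekindDomain Field
open Literature.NumberTheory.EllipticCurves Literature.NumberTheory.GaloisRepresentations Literature.NumberTheory.LocalFields
open Summit.BirchSwinnertonDyer.Rank1Residual.X11b.Halves
open Summit.BirchSwinnertonDyer.BirchSwinnertonDyer.Theorems.UniversalToricDescentThinComb

/-! ### §1. Values along a convergent sequence of outer points converge -/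

/-- **Values converge along convergent outer points.** On a closed disc `‖x‖ ≤ ‖ϖ‖ < 1` with the inner value `y` (`‖y‖ ≤ ‖ϖ‖`) fixed: if
`xₙ → x₀` inside the disc and `L` has the values `wₙ` at `(xₙ, y)` and `w₀` at `(x₀, y)`, then `wₙ → w₀` (uniform convergence of the series of
functions `x ↦ [T₁^iT₂^j]L·x^i y^j` on the disc). [cite: Gouvea1993PadicNumbers, §5.6 Cor. 5.6.3] -/
theorem tendsto_of_hasValueAt₂ {p : ℕ} [Fact p.Prime] {L : PowerSeries (UnrSeries p)} {ϖ : ℂ_[p]} (hϖ : ‖ϖ‖ < 1)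
    {x : ℕ → ℂ_[p]} {x₀ y : ℂ_[p]} (hx : ∀ n, ‖x n‖ ≤ ‖ϖ‖) (hx₀ : ‖x₀‖ ≤ ‖ϖ‖) (hy : ‖y‖ ≤ ‖ϖ‖)
    (hlim : Tendsto x atTop (𝓝 x₀)) {w : ℕ → ℂ_[p]} (hw : ∀ n, UnrSeries.HasValueAt₂ L (x n) y (w n))
    {w₀ : ℂ_[p]} (hw₀ : UnrSeries.HasValueAt₂ L x₀ y w₀) : Tendsto w atTop (𝓝 w₀) := by
  -- adapted from `…ThinComb.ValueLimits.hasValueAt₂_of_tendsto` (same majorant)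
  set a : ℕ × ℕ → ℂ_[p] := fun k ↦ ((PowerSeries.coeff k.2 (PowerSeries.coeff k.1 L) : unrIntegers p) : ℂ_[p]) with ha
  set F : ℂ_[p] → ℂ_[p] := fun z ↦ ∑' k : ℕ × ℕ, a k * z ^ k.1 * y ^ k.2 with hF
  set S : Set ℂ_[p] := {z | ‖z‖ ≤ ‖ϖ‖} with hS
  have hbound : ∀ (k : ℕ × ℕ), ∀ z ∈ S, ‖a k * z ^ k.1 * y ^ k.2‖ ≤ ‖ϖ‖ ^ k.1 * ‖ϖ‖ ^ k.2 := by
    intro k z hz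
    rw [norm_mul, norm_mul, norm_pow, norm_pow]
    calc ‖a k‖ * ‖z‖ ^ k.1 * ‖y‖ ^ k.2 ≤ 1 * ‖ϖ‖ ^ k.1 * ‖ϖ‖ ^ k.2 := by
          gcongr
          · exact norm_coe_unrIntegers_le_one (p := p) _
          · exact hz
      _ = ‖ϖ‖ ^ k.1 * ‖ϖ‖ ^ k.2 := by ring
  have hsum : Summable fun k : ℕ × ℕ ↦ ‖ϖ‖ ^ k.1 * ‖ϖ‖ ^ k.2 :=
    (summable_geometric_of_lt_one (norm_nonneg _) hϖ).mul_of_nonneg (summable_geometric_of_lt_one (norm_nonneg _) hϖ)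
      (fun _ ↦ pow_nonneg (norm_nonneg _) _) (fun _ ↦ pow_nonneg (norm_nonneg _) _)
  have hcont : ContinuousOn F S :=
    continuousOn_tsum (fun k ↦ ((continuous_const.mul (continuous_pow k.1)).mul continuous_const).continuousOn) hsum hbound
  have hval : ∀ z ∈ S, UnrSeries.HasValueAt₂ L z y (F z) := fun z hz ↦
    (Summable.of_norm_bounded hsum (fun k ↦ hbound k z hz)).hasSum
  have hwF : ∀ n, w n = F (x n) := fun n ↦ (hw n).unique (hval _ (hx n))
  have hw₀F : w₀ = F x₀ := hw₀.unique (hval _ hx₀)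
  have h1 : Tendsto x atTop (𝓝[S] x₀) := tendsto_nhdsWithin_iff.mpr ⟨hlim, Eventually.of_forall hx⟩
  have hFlim : Tendsto (fun n ↦ F (x n)) atTop (𝓝 (F x₀)) := (hcont x₀ hx₀).tendsto.comp h1
  rw [hw₀F]
  exact hFlim.congr fun n ↦ (hwF n).symm

/-! ### §2. The tame lemma on an abstract grid -/

/-- **THE TAME LEMMA.** Let `u, v₁, v₂` be one-units of level `|p|`, `L, G ∈ R₀⟦T₁⟧⟦T₂⟧` with values `VL i j`, `VG i j` at the grid points
`(v₁^{j+1}u^{i+1} − 1, v₂^{j+1} − 1)`, related by `VG i j · μ^{i+1} = μ^{j+1} · VL i j` for a `μ` with `‖μ‖ = 1`. Then ALL `VL i j = 0`, or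
`μ` is a one-unit: with `ζ = lim μ^{p^{n!}}` the Teichmüller representative of `μ`, letting `i → i + p^{n!}` (points → the `i`-th point, values →
values, `μ^{p^{n!}} → ζ`) gives `VG i j · μ^{i+1} · ζ = μ^{j+1} · VL i j`, so `(ζ − 1)·VG i j = 0`.
[cite: Robert2000PadicAnalysis, Ch. III §4.4 Theorem] [cite: Gouvea1993PadicNumbers, §5.6 Cor. 5.6.3] -/
theorem forall_eq_zero_or_norm_sub_one_lt_one_of_grid {p : ℕ} [Fact p.Prime] {L G : PowerSeries (UnrSeries p)} {u v₁ v₂ μ : ℂ_[p]}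
    (hu : ‖u - 1‖ < ‖(p : ℂ_[p])‖) (hv₁ : ‖v₁ - 1‖ < ‖(p : ℂ_[p])‖) (hv₂ : ‖v₂ - 1‖ < ‖(p : ℂ_[p])‖) (hμ : ‖μ‖ = 1)
    {VL VG : ℕ → ℕ → ℂ_[p]}
    (hVL : ∀ i j, UnrSeries.HasValueAt₂ L (v₁ ^ (j + 1) * u ^ (i + 1) - 1) (v₂ ^ (j + 1) - 1) (VL i j))
    (hVG : ∀ i j, UnrSeries.HasValueAt₂ G (v₁ ^ (j + 1) * u ^ (i + 1) - 1) (v₂ ^ (j + 1) - 1) (VG i j))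
    (hrel : ∀ i j, VG i j * μ ^ (i + 1) = μ ^ (j + 1) * VL i j) :
    (∀ i j, VL i j = 0) ∨ ‖μ - 1‖ < 1 := by
  have hp : p.Prime := Fact.out
  have hp1 : ‖(p : ℂ_[p])‖ < 1 := norm_prime_padicComplex_lt_one
  have hμ0 : μ ≠ 0 := norm_pos_iff.mp (by rw [hμ]; exact one_pos)
  -- the Teichmüller representative of `μ`
  obtain ⟨ζ, -, hμζ, hT⟩ := PadicComplex.tendsto_pow_prime_pow_factorial_nhds hμ
  by_cases hζ1 : ζ = 1
  · right; rwa [hζ1] at hμζ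
  left
  intro i j
  -- the fibre points lie in the closed disc of radius `‖p‖` and accumulate along `i + p^{n!}`
  have hu1 : ‖u - 1‖ ≤ 1 := (hu.trans hp1).le
  have hv₁1 : ‖v₁ - 1‖ ≤ 1 := (hv₁.trans hp1).le
  have hv₁n : ‖v₁‖ ≤ 1 := RamifiedSevenEllipticUnits.LemmaXi.norm_le_one_of_norm_sub_one_le_one hv₁1
  have hpt : ∀ n : ℕ, ‖v₁ ^ (j + 1) * u ^ n - 1‖ ≤ ‖(p : ℂ_[p])‖ := fun n ↦
    (FibredSupply.norm_mul_sub_one_lt (by rw [norm_pow]; exact pow_le_one₀ (norm_nonneg _) hv₁n)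
      ((RamifiedSevenEllipticUnits.LemmaXi.norm_pow_sub_one_le hv₁1 _).trans_lt hv₁)
      ((RamifiedSevenEllipticUnits.LemmaXi.norm_pow_sub_one_le hu1 _).trans_lt hu)).le
  have hy : ‖v₂ ^ (j + 1) - 1‖ ≤ ‖(p : ℂ_[p])‖ :=
    ((RamifiedSevenEllipticUnits.LemmaXi.norm_pow_sub_one_le (hv₂.trans hp1).le _).trans_lt hv₂).le
  have hxlim : Tendsto (fun n : ℕ ↦ v₁ ^ (j + 1) * u ^ (i + p ^ (Nat.factorial n) + 1) - 1) atTop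
      (𝓝 (v₁ ^ (j + 1) * u ^ (i + 1) - 1)) := by
    have h1 : ∀ n : ℕ, v₁ ^ (j + 1) * u ^ (i + p ^ (Nat.factorial n) + 1) - 1 =
        v₁ ^ (j + 1) * u ^ (i + 1) * u ^ (p ^ (Nat.factorial n)) - 1 := fun n ↦ by ring
    simp_rw [h1]
    simpa using ((PadicComplex.tendsto_pow_prime_pow_factorial_nhds_one (hu.trans hp1)).const_mul
      (v₁ ^ (j + 1) * u ^ (i + 1))).sub_const 1
  -- values converge (continuity in the outer variable)
  have hVLlim : Tendsto (fun n : ℕ ↦ VL (i + p ^ (Nat.factorial n)) j) atTop (𝓝 (VL i j)) :=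
    tendsto_of_hasValueAt₂ hp1 (fun n ↦ hpt _) (hpt _) hy hxlim (fun n ↦ hVL (i + p ^ (Nat.factorial n)) j) (hVL i j)
  have hVGlim : Tendsto (fun n : ℕ ↦ VG (i + p ^ (Nat.factorial n)) j) atTop (𝓝 (VG i j)) :=
    tendsto_of_hasValueAt₂ hp1 (fun n ↦ hpt _) (hpt _) hy hxlim (fun n ↦ hVG (i + p ^ (Nat.factorial n)) j) (hVG i j)
  have hμlim : Tendsto (fun n : ℕ ↦ μ ^ (i + p ^ (Nat.factorial n) + 1)) atTop (𝓝 (μ ^ (i + 1) * ζ)) := by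
    have h1 : ∀ n : ℕ, μ ^ (i + p ^ (Nat.factorial n) + 1) = μ ^ (i + 1) * μ ^ (p ^ (Nat.factorial n)) := fun n ↦ by ring
    simp_rw [h1]
    exact hT.const_mul _
  -- pass to the limit in the relation at `(i + p^{n!}, j)`
  have hlim1 : Tendsto (fun n : ℕ ↦ VG (i + p ^ (Nat.factorial n)) j * μ ^ (i + p ^ (Nat.factorial n) + 1)) atTop
      (𝓝 (VG i j * (μ ^ (i + 1) * ζ))) := hVGlim.mul hμlim
  have hlim2 : Tendsto (fun n : ℕ ↦ μ ^ (j + 1) * VL (i + p ^ (Nat.factorial n)) j) atTop (𝓝 (μ ^ (j + 1) * VL i j)) :=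
    hVLlim.const_mul _
  have heq : VG i j * (μ ^ (i + 1) * ζ) = μ ^ (j + 1) * VL i j :=
    tendsto_nhds_unique (hlim1.congr fun n ↦ hrel _ _) hlim2
  -- compare with the relation at `(i, j)`
  have hprod : VG i j * μ ^ (i + 1) * (ζ - 1) = 0 := by linear_combination heq - hrel i j
  have hVG0 : VG i j = 0 := by
    rcases mul_eq_zero.mp hprod with h | h
    · exact (mul_eq_zero.mp h).resolve_right (pow_ne_zero _ hμ0)
    · exact absurd (sub_eq_zero.mp h) hζ1
  have h := hrel i j
  rw [hVG0, zero_mul] at h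
  exact (mul_eq_zero.mp h.symm).resolve_left (pow_ne_zero _ hμ0)

/-! ### §3. Tame rigidity of ♯♯-frames (`p = 3`) -/

variable {K : Type} [Field K] [NumberField K]

/-- **TAME RIGIDITY OF ♯♯-FRAMES.** `K` imaginary quadratic Heegner for `N`, `3 = 𝔭𝔭′` with `𝔭` of degree one induced by `ι′`, `(κ₁, κ₂; γ₁, γ₂)`
a generator pair with `κ₁` unramified outside `𝔭`, `f = Dt.f`; Jacquet's cone fact BY NAME. There is ONE exponent `m > 0` (that of a grid supply of
the pair) such that EVERY non-zero ♯♯-frame `L₂`, with any constants `(C, X, Y)`, `X, Y ≠ 0`, satisfies `‖(X·κ̂·Y⁻¹)^m − 1‖ < 1`, `κ̂ = ι′⁻¹(N·|d_K|/4)`: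
the grading ratio `λ₀ = X·κ̂/Y` is (size rigidity) a unit of `ℂ₃` whose Teichmüller part is an `m`-th root of unity. Proof: the reflected frame
`φ_{A_τ}L₂` has grid values `μ^{j+1}μ^{−(i+1)}·L₂(P_{ij})`, `μ = λ₀^m` of norm one; §2.
[cite: Robert2000PadicAnalysis, Ch. III §4.4 Theorem] [cite: HaoLoeffler2025, Thm. 3.5, remark (arXiv:2405.12611)] [cite: Jacquet1972, §19 Cor. 19.15] -/
theorem exists_forall_norm_pow_sub_one_lt_one_of_isToricTwoVarLFunctionUpTo₂
    (hJ : jacquet1972_functionalEquation_rankinSelbergHecke_cone)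
    (hK : IsImaginaryQuadratic K) {N : ℕ} [NeZero N] (W : WeierstrassCurve ℚ)
    (Dt : Literature.NumberTheory.EllipticCurves.ModularForms.ModularParametrizationData W N)
    (hH : SatisfiesHeegnerHypothesis N K)
    {𝔭 : HeightOneSpectrum (𝓞 K)} (h3 : ((3 : ℕ) : 𝓞 K) ∈ 𝔭.asIdeal)
    {𝔭' : HeightOneSpectrum (𝓞 K)} (h3' : ((3 : ℕ) : 𝓞 K) ∈ 𝔭'.asIdeal) (hne : 𝔭' ≠ 𝔭)
    (ι' : PadicAlgCl 3 ≃+* ℂ) (hι : Summit.BirchSwinnertonDyer.BirchSwinnertonDyer.Theorems.SchneiderFree.BranchInducesPrime 3 ι' 𝔭)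
    {κ₁ κ₂ : ZpExtension K 3} {γ₁ γ₂ : absoluteGaloisGroup K} (hpair : ZpExtension.IsTopGeneratorPair κ₁ κ₂ γ₁ γ₂)
    (hur₁ : ∀ v : HeightOneSpectrum (𝓞 K), v ≠ 𝔭 → ∀ 𝔓 ∈ v.primesAbove,
      𝔓.inertia (absoluteGaloisGroup K) ≤ κ₁.kerSubgroup) :
    ∃ m : ℕ, 0 < m ∧ ∀ (ΩK : ℂ) (C X Y : ℂ_[3]) (L₂ : PowerSeries (UnrSeries 3)), X ≠ 0 → Y ≠ 0 →
      IsToricTwoVarLFunctionUpTo₂ C X Y ι' 𝔭 𝔭' κ₁ κ₂ γ₁ γ₂ Dt.f ΩK L₂ → L₂ ≠ 0 →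
      ‖(X * (((ι'.symm ((N : ℂ) * ((NumberField.discr K).natAbs : ℂ) / 4) : PadicAlgCl 3)) : ℂ_[3]) * Y⁻¹) ^ m - 1‖ < 1 := by
  letI : Algebra ℤ_[3] (unrIntegers 3) := (toUnr 3).toAlgebra
  -- the frame involution and ONE grid supply of the pair (both independent of the frame)
  obtain ⟨c, hc⟩ := FrameInvolution.exists_not_mem_range_absGaloisRestrict_rat hK
  obtain ⟨τ, hτ⟩ := FrameInvolution.exists_conjInv hK.1 c
  obtain ⟨A, hA, -⟩ := FrameInvolution.exists_GL_eq_frameMatrixOf_of_conjInv hK hpair hτ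
  obtain ⟨u, v₁, v₂, m, hm, hu, hv₁, hv₂, hut, hv₂t, grid⟩ :=
    GridSupply.gridSupply hJ (by norm_num) hK W Dt hH h3 h3' hne ι' hι hpair hur₁ hc hτ
  choose ψ r Lc hinf hunr hr hrκ hLd hLe hx hy using grid
  refine ⟨m, hm, fun ΩK C X Y L₂ hX hY hL hL0 ↦ ?_⟩
  -- the reflected frame and the grading ratio
  have hG := FrameReflection.isToricTwoVarLFunctionUpTo₂_frameSubst_involution hJ hK Dt.f Dt.isNewformOf.1 hH h3 h3' hne ι'
    hpair hc hτ A hA hL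
  set G : PowerSeries (UnrSeries 3) := IwasawaAlgebra₂.frameSubst (unrIntegers 3) A L₂ with hGdef
  have hsize := SizeRigidity.norm_mul_eq_norm_of_isToricTwoVarLFunctionUpTo₂ hJ hK W Dt hH h3 h3' hne ι' hι hpair hur₁ hX hY hL hL0
  set κh : ℂ_[3] := (((ι'.symm ((N : ℂ) * ((NumberField.discr K).natAbs : ℂ) / 4) : PadicAlgCl 3)) : ℂ_[3]) with hκh
  have hκh0 : κh ≠ 0 := by
    intro h0; rw [h0, mul_zero, norm_zero] at hsize; exact hY (norm_eq_zero.mp hsize.symm)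
  set lam : ℂ_[3] := X * κh * Y⁻¹ with hlam
  have hlam1 : ‖lam‖ = 1 := by
    rw [hlam, norm_mul, norm_inv, hsize, mul_inv_cancel₀ (norm_ne_zero_iff.mpr hY)]
  have h31 : ‖((3 : ℕ) : ℂ_[3])‖ < 1 := norm_prime_padicComplex_lt_one
  have h30 : ((3 : ℕ) : ℂ_[3]) ≠ 0 := by exact_mod_cast (show (3 : ℕ) ≠ 0 by norm_num)
  have hu1 : ‖u - 1‖ ≤ 1 := (hu.trans h31).le
  have hv₁1 : ‖v₁ - 1‖ ≤ 1 := (hv₁.trans h31).le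
  have hv₂1 : ‖v₂ - 1‖ ≤ 1 := (hv₂.trans h31).le
  have hu_ne : u ≠ 0 := fun h ↦ by rw [h, zero_sub, norm_neg, norm_one] at hu; exact (lt_irrefl _) (hu.trans h31)
  have hv₁_ne : v₁ ≠ 0 := fun h ↦ by rw [h, zero_sub, norm_neg, norm_one] at hv₁; exact (lt_irrefl _) (hv₁.trans h31)
  have hv₂_ne : v₂ ≠ 0 := fun h ↦ by rw [h, zero_sub, norm_neg, norm_one] at hv₂; exact (lt_irrefl _) (hv₂.trans h31)
  have hv₁n : ‖v₁‖ ≤ 1 := RamifiedSevenEllipticUnits.LemmaXi.norm_le_one_of_norm_sub_one_le_one hv₁1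
  have hv₁pow : ∀ j : ℕ, ‖v₁ ^ (j + 1) - 1‖ < ‖((3 : ℕ) : ℂ_[3])‖ := fun j ↦
    (RamifiedSevenEllipticUnits.LemmaXi.norm_pow_sub_one_le hv₁1 _).trans_lt hv₁
  have hv₂pow : ∀ j : ℕ, ‖v₂ ^ (j + 1) - 1‖ ≤ ‖((3 : ℕ) : ℂ_[3])‖ := fun j ↦
    ((RamifiedSevenEllipticUnits.LemmaXi.norm_pow_sub_one_le hv₂1 _).trans_lt hv₂).le
  have hpt : ∀ i j : ℕ, ‖v₁ ^ (j + 1) * u ^ (i + 1) - 1‖ ≤ ‖((3 : ℕ) : ℂ_[3])‖ := fun i j ↦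
    (FibredSupply.norm_mul_sub_one_lt (by rw [norm_pow]; exact pow_le_one₀ (norm_nonneg _) hv₁n) (hv₁pow j)
      ((RamifiedSevenEllipticUnits.LemmaXi.norm_pow_sub_one_le hu1 _).trans_lt hu)).le
  have hinjD : Function.Injective fun j : ℕ ↦ v₂ ^ (j + 1) - 1 := by
    simpa only [one_mul] using FibredSupply.injective_mul_pow_sub_one one_ne_zero hv₂_ne hv₂t
  have hinjF : ∀ j : ℕ, Function.Injective fun i : ℕ ↦ v₁ ^ (j + 1) * u ^ (i + 1) - 1 := fun j ↦
    FibredSupply.injective_mul_pow_sub_one (pow_ne_zero _ hv₁_ne) hu_ne hut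
  -- the two value families on the grid
  obtain ⟨D, hD⟩ : ∃ D : ℕ → ℕ → ℂ_[3], ∀ i j, D i j =
      (((ι'.symm (toricInterpolationValue 3 Dt.f 𝔭 𝔭' (ψ i j) (m * (i + 1)) (m * (j + 1)) ΩK (Lc i j 1))) : PadicAlgCl 3) :
        ℂ_[3]) := ⟨_, fun _ _ ↦ rfl⟩
  obtain ⟨VL, hVL⟩ : ∃ VL : ℕ → ℕ → ℂ_[3], ∀ i j, VL i j = C * X ^ (m * (i + 1)) * Y ^ (m * (j + 1)) * D i j :=
    ⟨_, fun _ _ ↦ rfl⟩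
  obtain ⟨VG, hVG⟩ : ∃ VG : ℕ → ℕ → ℂ_[3], ∀ i j,
      VG i j = C * (Y * κh⁻¹) ^ (m * (i + 1)) * (X * κh) ^ (m * (j + 1)) * D i j := ⟨_, fun _ _ ↦ rfl⟩
  have ha : ∀ i : ℕ, 1 ≤ m * (i + 1) := fun i ↦ Nat.mul_pos hm (Nat.succ_pos i)
  have hvalL : ∀ i j, UnrSeries.HasValueAt₂ L₂ (v₁ ^ (j + 1) * u ^ (i + 1) - 1) (v₂ ^ (j + 1) - 1) (VL i j) := by
    intro i j
    have h := hL (ψ i j) _ _ (ha i) (ha j) (hinf i j) (hunr i j) (r i j) (hr i j) (hrκ i j) (Lc i j) (hLd i j) (hLe i j)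
    rw [hx i j, hy i j, ← hD] at h
    rwa [hVL]
  have hvalG : ∀ i j, UnrSeries.HasValueAt₂ G (v₁ ^ (j + 1) * u ^ (i + 1) - 1) (v₂ ^ (j + 1) - 1) (VG i j) := by
    intro i j
    have h := hG (ψ i j) _ _ (ha i) (ha j) (hinf i j) (hunr i j) (r i j) (hr i j) (hrκ i j) (Lc i j) (hLd i j) (hLe i j)
    rw [hx i j, hy i j, ← hD] at h
    rwa [hVG]
  -- the relation `VG · μ^{i+1} = μ^{j+1} · VL`, `μ = λ₀^m`
  have hrel : ∀ i j, VG i j * (lam ^ m) ^ (i + 1) = (lam ^ m) ^ (j + 1) * VL i j := by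
    intro i j
    have e1 : Y * κh⁻¹ * lam = X := by
      rw [hlam]
      calc Y * κh⁻¹ * (X * κh * Y⁻¹) = X * (κh⁻¹ * κh) * (Y * Y⁻¹) := by ring
        _ = X := by rw [inv_mul_cancel₀ hκh0, mul_inv_cancel₀ hY, mul_one, mul_one]
    have e2 : lam * Y = X * κh := by
      rw [hlam]
      calc X * κh * Y⁻¹ * Y = X * κh * (Y⁻¹ * Y) := by ring
        _ = X * κh := by rw [inv_mul_cancel₀ hY, mul_one]
    rw [← pow_mul, ← pow_mul]
    calc VG i j * lam ^ (m * (i + 1))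
        = C * (Y * κh⁻¹ * lam) ^ (m * (i + 1)) * (X * κh) ^ (m * (j + 1)) * D i j := by rw [hVG, mul_pow]; ring
      _ = C * X ^ (m * (i + 1)) * (lam * Y) ^ (m * (j + 1)) * D i j := by rw [e1, e2]
      _ = lam ^ (m * (j + 1)) * VL i j := by rw [hVL, mul_pow]; ring
  have hμ : ‖lam ^ m‖ = 1 := by rw [norm_pow, hlam1, one_pow]
  -- the tame lemma: either all values of `L₂` on the grid vanish (then `L₂ = 0`), or `λ₀^m` is a one-unit
  rcases forall_eq_zero_or_norm_sub_one_lt_one_of_grid hu hv₁ hv₂ hμ hvalL hvalG hrel with hzero | hone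
  · exfalso
    apply hL0
    refine ReflectionTransfer.unr_eq_zero_of_infinite_zeros₂_innerFibred h30 h31 (Set.infinite_range_of_injective hinjD) ?_ ?_
    · rintro y ⟨j, rfl⟩; exact hv₂pow j
    · rintro y ⟨j, rfl⟩
      refine Set.infinite_of_injective_forall_mem (hinjF j) fun i ↦ ⟨hpt i j, ?_⟩
      have hv := hvalL i j
      rwa [hzero i j] at hv
  · exact hone

/-- **SIZE + TAME RIGIDITY, decomposition form**: with the exponent `m` of the previous theorem, the grading ratio of every non-zero ♯♯-frame
factors as `X·κ̂/Y = ζ·ν` with `ζ^m = 1` and `ν ∈ 1 + 𝔪_{ℂ₃}` (`‖λ₀‖ = 1` by `…SizeRigidity`; `λ₀ = ζ₀·u₀` with `ζ₀` of order prime to `3`,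
Robert III.4.2 `PadicComplex.exists_rootOfUnity_mul_oneUnit`; `ζ₀^m ≡ λ₀^m ≡ 1` forces `ζ₀^m = 1` by the uniqueness of Teichmüller representatives).
(N♭) asserts `ζ = ±1`-type and `ν ∈ 1 + 3ℤ₃` (`λ₀⁻¹ ∈ ℤ₃ˣ`); what is NOT proved is the wild condition on `ν`.
[cite: Robert2000PadicAnalysis, Ch. III §4.2, §4.4 Theorem] [cite: HaoLoeffler2025, Thm. 3.5 (arXiv:2405.12611)] -/
theorem exists_forall_eq_rootOfUnity_mul_oneUnit_of_isToricTwoVarLFunctionUpTo₂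
    (hJ : jacquet1972_functionalEquation_rankinSelbergHecke_cone)
    (hK : IsImaginaryQuadratic K) {N : ℕ} [NeZero N] (W : WeierstrassCurve ℚ)
    (Dt : Literature.NumberTheory.EllipticCurves.ModularForms.ModularParametrizationData W N)
    (hH : SatisfiesHeegnerHypothesis N K)
    {𝔭 : HeightOneSpectrum (𝓞 K)} (h3 : ((3 : ℕ) : 𝓞 K) ∈ 𝔭.asIdeal)
    {𝔭' : HeightOneSpectrum (𝓞 K)} (h3' : ((3 : ℕ) : 𝓞 K) ∈ 𝔭'.asIdeal) (hne : 𝔭' ≠ 𝔭)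
    (ι' : PadicAlgCl 3 ≃+* ℂ) (hι : Summit.BirchSwinnertonDyer.BirchSwinnertonDyer.Theorems.SchneiderFree.BranchInducesPrime 3 ι' 𝔭)
    {κ₁ κ₂ : ZpExtension K 3} {γ₁ γ₂ : absoluteGaloisGroup K} (hpair : ZpExtension.IsTopGeneratorPair κ₁ κ₂ γ₁ γ₂)
    (hur₁ : ∀ v : HeightOneSpectrum (𝓞 K), v ≠ 𝔭 → ∀ 𝔓 ∈ v.primesAbove,
      𝔓.inertia (absoluteGaloisGroup K) ≤ κ₁.kerSubgroup) :
    ∃ m : ℕ, 0 < m ∧ ∀ (ΩK : ℂ) (C X Y : ℂ_[3]) (L₂ : PowerSeries (UnrSeries 3)), X ≠ 0 → Y ≠ 0 →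
      IsToricTwoVarLFunctionUpTo₂ C X Y ι' 𝔭 𝔭' κ₁ κ₂ γ₁ γ₂ Dt.f ΩK L₂ → L₂ ≠ 0 →
      ∃ ζ ν : ℂ_[3], ζ ^ m = 1 ∧ ‖ν - 1‖ < 1 ∧
        X * (((ι'.symm ((N : ℂ) * ((NumberField.discr K).natAbs : ℂ) / 4) : PadicAlgCl 3)) : ℂ_[3]) * Y⁻¹ = ζ * ν := by
  obtain ⟨m, hm, htame⟩ :=
    exists_forall_norm_pow_sub_one_lt_one_of_isToricTwoVarLFunctionUpTo₂ hJ hK W Dt hH h3 h3' hne ι' hι hpair hur₁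
  refine ⟨m, hm, fun ΩK C X Y L₂ hX hY hL hL0 ↦ ?_⟩
  have hsize := SizeRigidity.norm_mul_eq_norm_of_isToricTwoVarLFunctionUpTo₂ hJ hK W Dt hH h3 h3' hne ι' hι hpair hur₁ hX hY hL hL0
  have ht := htame ΩK C X Y L₂ hX hY hL hL0
  set lam : ℂ_[3] := X * (((ι'.symm ((N : ℂ) * ((NumberField.discr K).natAbs : ℂ) / 4) : PadicAlgCl 3)) : ℂ_[3]) * Y⁻¹ with hlam
  have hlam1 : ‖lam‖ = 1 := by
    rw [hlam, norm_mul, norm_inv, hsize, mul_inv_cancel₀ (norm_ne_zero_iff.mpr hY)]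
  -- `λ₀ = ζ₀ · u₀`, `ζ₀` of order prime to `3`, `u₀` a one-unit
  obtain ⟨ζ₀, u₀, ⟨m₀, hm₀, h3m₀, hζ₀⟩, hu₀, hdec⟩ := PadicComplex.exists_rootOfUnity_mul_oneUnit hlam1
  refine ⟨ζ₀, u₀, ?_, hu₀, hdec⟩
  -- `ζ₀^m` is a root of unity of order prime to `3` congruent to `1`, hence `= 1`
  have hu₀0 : u₀ ≠ 0 := fun h ↦ by rw [h, zero_sub, norm_neg, norm_one] at hu₀; exact lt_irrefl _ hu₀
  have hum : ‖(u₀ ^ m)⁻¹ - 1‖ < 1 := by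
    rw [RamifiedSevenEllipticUnits.LemmaXi.norm_inv_sub_one_eq
      ((RamifiedSevenEllipticUnits.LemmaXi.norm_pow_sub_one_le hu₀.le m).trans_lt hu₀)]
    exact (RamifiedSevenEllipticUnits.LemmaXi.norm_pow_sub_one_le hu₀.le m).trans_lt hu₀
  have hζm : ζ₀ ^ m = lam ^ m * (u₀ ^ m)⁻¹ := by
    rw [hdec, mul_pow, mul_assoc, mul_inv_cancel₀ (pow_ne_zero _ hu₀0), mul_one]
  have hζm1 : ‖ζ₀ ^ m - 1‖ < 1 := by
    rw [hζm]
    exact FibredSupply.norm_mul_sub_one_lt (by rw [norm_pow, hlam1, one_pow]) ht hum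
  have hζmm₀ : (ζ₀ ^ m) ^ m₀ = 1 := by rw [← pow_mul, mul_comm, pow_mul, hζ₀, one_pow]
  exact eq_of_pow_eq_one_of_norm_sub_lt_one_of_not_dvd 3 h3m₀ (m₂ := 1) (by norm_num) hζmm₀ (one_pow 1) hζm1

end Summit.BirchSwinnertonDyer.BirchSwinnertonDyer.Theorems.UniversalToricDescentThinComb.TameRigidity

end
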